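import Summits.Ventures.LatticeQCDFlow.Scaling.SwapLadderRoundTripSpacing
import Summits.Ventures.LatticeQCDFlow.Scaling.SwapLadderLogConcave

/-!
HONEST FRAMING: exact (Metropolis-corrected) sampling algorithms for lattice gauge theory; figures
of merit are autocorrelation/cost numbers at stated couplings and volumes; no continuum-physics
claim.

# SwapLadderRoundTripSpacingOptimum — THE EXACT UNIFORM ROUND TRIP `(Λ/ℓ)(Λ/ℓ+1)/erfc(ℓ/(2√2))` IS
# STRICTLY LOG-CONVEX IN THE SPACING, SO FOR EVERY TOTAL STIFFNESS `Λ > 0` IT HAS EXACTLY ONE OPTIMAL SPACING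
# `ℓ_Λ`, AND `ℓ_Λ ≤ ℓ⋆`: THE FINITE-LADDER OPTIMAL ACCEPTANCE IS `≥ a⋆` (row 22 `su3-ptbc`, GEN-5, ours;
# closes the 'NOT CLAIMED: existence/uniqueness of the exact optimum spacing' of `SwapLadderRoundTripSpacing`)

Venture `LatticeQCDFlow` (cell pub-lqcd), topic `Scaling`; FANOUT row 22 (`su3-ptbc`).  NEW WORK of the cell
= elementary calculus over `SwapLadderRoundTripSpacing` (`uniformRT`, `strictMonoOn_uniformRT`,
`uniformRT_pos`, `ladderCost_le_uniformRT`), `SwapLadderLogConcave` (`erfcLogDeriv`, `strictAnti_erfcLogDeriv`,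
`hasDerivAt_log_gaussAcc` — the log-concavity of `erfc`) and Mathlib (`StrictMonoOn.strictConvexOn_of_deriv`,
`StrictConvexOn.eq_of_isMinOn`, `IsCompact.exists_isMinOn`).  Nothing is cited as a fact.

* `logUniformRT Λ ℓ = log Λ + (log(Λ+ℓ) − 2 log ℓ − log erfc(ℓ/(2√2)))` `= log (uniformRT Λ ℓ)` on `ℓ > 0`
  (`log_uniformRT`); `hasDerivAt_logUniformRT` — derivative
  `uniformRTLogDeriv Λ ℓ = 1/(Λ+ℓ) − 2/ℓ − erfcLogDeriv(ℓ/(2√2))/(2√2)`;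
* `strictMonoOn_uniformRTLogDeriv` — strictly increasing on `(0, ∞)` (`2/ℓ − 1/(Λ+ℓ)` strictly decreasing,
  `−(log erfc)′` strictly increasing); **`strictConvexOn_logUniformRT`** — `log ∘ uniformRT Λ` is STRICTLY
  CONVEX on `(0, ∞)`;
* **`exists_isMinOn_uniformRT`** — a minimiser of `uniformRT Λ` on `(0, ∞)` exists and lies in `(0, ℓ⋆]`
  (blow-up `≥ Λ²/ℓ²` at `0`, compactness on `[ε, ℓ⋆]`, the increasing branch `[ℓ⋆, ∞)` of
  `strictMonoOn_uniformRT`); **`isMinOn_uniformRT_unique`** — it is unique;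
  **`erfc_argmin_ge_aOpt`** — every minimiser `ℓ₀` has `ℓ₀ ≤ ℓ⋆` and model acceptance
  `erfc(ℓ₀/(2√2)) ≥ a⋆` (`> 0.2334`, `SwapAcceptanceOptimumSharp`): at every finite total stiffness the
  exact model prefers a swap acceptance ABOVE `a⋆ ≈ 0.234`, i.e. MORE replicas than GEN-4's proxy, never fewer
  — the card's `0.20` errs on the cheap side by the bounded factor of `SwapLadderRoundTripSpacing`.

NOT CLAIMED: a closed form or enclosure for `ℓ_Λ` (it tends to `ℓ⋆` as `Λ → ∞`; not typed); integrality of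
`K = Λ/ℓ`; that the model describes PTBC; any number of a run.
-/

noncomputable section

open Real Set
open Literature.ComputerArithmetic.BrentZimmermann2010.AsymptoticExpansions (erfc erfc_pos)

namespace Summit.Ventures.LatticeQCDFlow.Scaling

section LogConvex

/-- `log (uniformRT Λ ℓ)` written out: `log Λ + (log(Λ+ℓ) − 2 log ℓ − log erfc(ℓ/(2√2)))`. [ours] -/
def logUniformRT (Λ ℓ : ℝ) : ℝ :=
  Real.log Λ + (Real.log (Λ + ℓ) - 2 * Real.log ℓ - Real.log (erfc (ℓ / (2 * sqrt 2))))

/-- `log (uniformRT Λ ℓ) = logUniformRT Λ ℓ` for `Λ, ℓ > 0`. [ours] -/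
theorem log_uniformRT {Λ ℓ : ℝ} (hΛ : 0 < Λ) (hℓ : 0 < ℓ) :
    Real.log (uniformRT Λ ℓ) = logUniformRT Λ ℓ := by
  have hA : 0 < erfc (ℓ / (2 * sqrt 2)) := erfc_pos _
  have e : uniformRT Λ ℓ = Λ * (Λ + ℓ) / (ℓ ^ 2 * erfc (ℓ / (2 * sqrt 2))) := by
    unfold uniformRT; field_simp
  rw [e, Real.log_div (by positivity) (by positivity), Real.log_mul hΛ.ne' (by positivity),
    Real.log_mul (by positivity) hA.ne', Real.log_pow]
  unfold logUniformRT
  push_cast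
  ring

/-- The derivative of `logUniformRT Λ` at `ℓ > 0`. [ours] -/
def uniformRTLogDeriv (Λ ℓ : ℝ) : ℝ :=
  1 / (Λ + ℓ) - 2 * ℓ⁻¹ - erfcLogDeriv (ℓ / (2 * sqrt 2)) * (1 / (2 * sqrt 2))

/-- `(logUniformRT Λ)′(ℓ) = uniformRTLogDeriv Λ ℓ` (`Λ, ℓ > 0`). [ours] -/
theorem hasDerivAt_logUniformRT {Λ ℓ : ℝ} (hΛ : 0 < Λ) (hℓ : 0 < ℓ) :
    HasDerivAt (logUniformRT Λ) (uniformRTLogDeriv Λ ℓ) ℓ := by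
  have h1 : HasDerivAt (fun y => Real.log (Λ + y)) (1 / (Λ + ℓ)) ℓ := by
    have h := ((hasDerivAt_id ℓ).const_add Λ).log (by simp only [id]; positivity)
    simpa only [id] using h
  have h2 : HasDerivAt (fun y => 2 * Real.log y) (2 * ℓ⁻¹) ℓ := (Real.hasDerivAt_log hℓ.ne').const_mul 2
  have h3 : HasDerivAt (fun y => Real.log (erfc (y / (2 * sqrt 2))))
      (erfcLogDeriv (ℓ / (2 * sqrt 2)) * (1 / (2 * sqrt 2))) ℓ := hasDerivAt_log_gaussAcc ℓ
  exact ((h1.sub h2).sub h3).const_add (Real.log Λ)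

/-- The rational part `1/(Λ+ℓ) − 2/ℓ` is strictly increasing on `(0, ∞)` (`Λ > 0`). [folklore] -/
theorem rational_part_strictMonoOn {Λ : ℝ} (hΛ : 0 < Λ) :
    StrictMonoOn (fun ℓ : ℝ => 1 / (Λ + ℓ) - 2 * ℓ⁻¹) (Ioi 0) := by
  intro a ha b hb hab
  have ha0 : 0 < a := ha
  have hb0 : 0 < b := hb
  have hΛa : 0 < Λ + a := by linarith
  have hΛb : 0 < Λ + b := by linarith
  show 1 / (Λ + a) - 2 * a⁻¹ < 1 / (Λ + b) - 2 * b⁻¹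
  rw [← one_div, ← one_div]
  -- `(b − a)·(2/(ab) − 1/((Λ+a)(Λ+b))) > 0`
  have key : (1 / (Λ + b) - 2 * (1 / b)) - (1 / (Λ + a) - 2 * (1 / a))
      = (b - a) * (2 * ((Λ + a) * (Λ + b)) - a * b) / (a * b * ((Λ + a) * (Λ + b))) := by
    field_simp
    ring
  have hpos : 0 < (b - a) * (2 * ((Λ + a) * (Λ + b)) - a * b) / (a * b * ((Λ + a) * (Λ + b))) := by
    apply div_pos _ (by positivity)
    apply mul_pos (by linarith)
    nlinarith [mul_pos ha0 hb0, mul_pos hΛ hΛ, mul_pos hΛ ha0, mul_pos hΛ hb0]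
  linarith [key, hpos]

/-- **`(log uniformRT)′` is strictly increasing on `(0, ∞)`** (`Λ > 0`). [ours] -/
theorem strictMonoOn_uniformRTLogDeriv {Λ : ℝ} (hΛ : 0 < Λ) : StrictMonoOn (uniformRTLogDeriv Λ) (Ioi 0) := by
  intro a ha b hb hab
  have h1 := rational_part_strictMonoOn hΛ ha hb hab
  simp only at h1
  have hc : (0 : ℝ) < 1 / (2 * sqrt 2) := by positivity
  have hab' : a / (2 * sqrt 2) < b / (2 * sqrt 2) := div_lt_div_of_pos_right hab (by positivity)
  have h2 := strictAnti_erfcLogDeriv hab'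
  unfold uniformRTLogDeriv
  nlinarith

/-- `logUniformRT Λ` is continuous on `(0, ∞)`. [ours] -/
theorem continuousOn_logUniformRT {Λ : ℝ} (hΛ : 0 < Λ) : ContinuousOn (logUniformRT Λ) (Ioi 0) :=
  fun _ hx => (hasDerivAt_logUniformRT hΛ hx).continuousAt.continuousWithinAt

/-- **`log ∘ uniformRT Λ` IS STRICTLY CONVEX ON `(0, ∞)`** (`Λ > 0`): the exact uniform round trip is strictly
log-convex in the spacing. [ours] -/
theorem strictConvexOn_logUniformRT {Λ : ℝ} (hΛ : 0 < Λ) : StrictConvexOn ℝ (Ioi 0) (logUniformRT Λ) := by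
  refine (StrictMonoOn.strictConvexOn_of_deriv (convex_Ioi 0) (continuousOn_logUniformRT hΛ) ?_)
  rw [interior_Ioi]
  intro a ha b hb hab
  rw [(hasDerivAt_logUniformRT hΛ ha).deriv, (hasDerivAt_logUniformRT hΛ hb).deriv]
  exact strictMonoOn_uniformRTLogDeriv hΛ ha hb hab

end LogConvex

section Argmin

/-- `uniformRT Λ` is continuous on `(0, ∞)` (`= exp ∘ logUniformRT Λ` there). [ours] -/
theorem continuousOn_uniformRT {Λ : ℝ} (hΛ : 0 < Λ) : ContinuousOn (uniformRT Λ) (Ioi 0) := by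
  have h := (continuousOn_logUniformRT hΛ).rexp
  refine h.congr fun ℓ hℓ => ?_
  show uniformRT Λ ℓ = exp (logUniformRT Λ ℓ)
  rw [← log_uniformRT hΛ hℓ, Real.exp_log (uniformRT_pos hΛ hℓ)]

/-- Near `0` the round trip blows up: `Λ²/ℓ² ≤ uniformRT Λ ℓ` (`Λ ≥ 0`, `ℓ > 0`; `erfc ≤ 1` on `[0, ∞)`). [ours] -/
theorem sq_div_sq_le_uniformRT {Λ ℓ : ℝ} (hΛ : 0 ≤ Λ) (hℓ : 0 < ℓ) : Λ ^ 2 / ℓ ^ 2 ≤ uniformRT Λ ℓ := by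
  refine le_trans ?_ (ladderCost_le_uniformRT hΛ hℓ)
  unfold ladderCost
  rw [div_pow]
  have hA1 : erfc (ℓ / (2 * sqrt 2)) ≤ 1 := (erfc_lt_one_of_pos (by positivity)).le
  have hA0 : 0 < erfc (ℓ / (2 * sqrt 2)) := erfc_pos _
  rw [le_div_iff₀ hA0]
  have h0 : 0 ≤ Λ ^ 2 / ℓ ^ 2 := by positivity
  nlinarith

/-- **A MINIMISER OF THE EXACT UNIFORM ROUND TRIP EXISTS, IN `(0, ℓ⋆]`** (`Λ > 0`). [ours] -/
theorem exists_isMinOn_uniformRT {Λ : ℝ} (hΛ : 0 < Λ) :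
    ∃ ℓ₀ ∈ Ioc 0 optSpacing, IsMinOn (uniformRT Λ) (Ioi 0) ℓ₀ := by
  set R := uniformRT Λ optSpacing with hR
  have hRpos : 0 < R := uniformRT_pos hΛ optSpacing_pos
  -- a cut-off `ε ≤ ℓ⋆` below which `uniformRT ≥ Λ²/ε² ≥ R`
  set ε := min optSpacing (Λ ^ 2 / (R * optSpacing)) with hεdef
  have hεpos : 0 < ε := lt_min optSpacing_pos (div_pos (pow_pos hΛ 2) (mul_pos hRpos optSpacing_pos))
  have hεle : ε ≤ optSpacing := min_le_left _ _
  have hεle' : ε ≤ Λ ^ 2 / (R * optSpacing) := min_le_right _ _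
  have hεsq : ε ^ 2 ≤ Λ ^ 2 / R := by
    have h1 : ε ^ 2 ≤ optSpacing * (Λ ^ 2 / (R * optSpacing)) := by
      rw [sq]; exact mul_le_mul hεle hεle' hεpos.le optSpacing_pos.le
    have h2 : optSpacing * (Λ ^ 2 / (R * optSpacing)) = Λ ^ 2 / R := by
      have hs := optSpacing_pos.ne'
      have hr := hRpos.ne'
      field_simp
    linarith [h1, h2.le]
  have hbelow : ∀ ℓ, 0 < ℓ → ℓ ≤ ε → R ≤ uniformRT Λ ℓ := by
    intro ℓ hℓ hℓε
    have h1 := sq_div_sq_le_uniformRT hΛ.le hℓ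
    have h2 : Λ ^ 2 / ε ^ 2 ≤ Λ ^ 2 / ℓ ^ 2 :=
      div_le_div_of_nonneg_left (sq_nonneg Λ) (pow_pos hℓ 2) (pow_le_pow_left₀ hℓ.le hℓε 2)
    have h3 : R ≤ Λ ^ 2 / ε ^ 2 := by
      rw [le_div_iff₀ (pow_pos hεpos 2)]
      have := mul_le_mul_of_nonneg_left hεsq hRpos.le
      rwa [mul_div_cancel₀ _ hRpos.ne'] at this
    linarith
  -- minimum on the compact `[ε, ℓ⋆]`
  have hK : IsCompact (Icc ε optSpacing) := isCompact_Icc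
  have hKne : (Icc ε optSpacing).Nonempty := nonempty_Icc.mpr hεle
  have hKsub : Icc ε optSpacing ⊆ Ioi 0 := fun x hx => lt_of_lt_of_le hεpos hx.1
  obtain ⟨ℓ₀, hℓ₀K, hmin⟩ := hK.exists_isMinOn hKne ((continuousOn_uniformRT hΛ).mono hKsub)
  have hℓ₀pos : 0 < ℓ₀ := hKsub hℓ₀K
  have hℓ₀R : uniformRT Λ ℓ₀ ≤ R := hmin ⟨hεle, le_rfl⟩
  refine ⟨ℓ₀, ⟨hℓ₀pos, hℓ₀K.2⟩, fun ℓ hℓ => ?_⟩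
  have hℓpos : 0 < ℓ := hℓ
  show uniformRT Λ ℓ₀ ≤ uniformRT Λ ℓ
  rcases lt_or_ge ℓ ε with hlt | hge
  · exact hℓ₀R.trans (hbelow ℓ hℓpos hlt.le)
  rcases le_or_gt ℓ optSpacing with hle | hgt
  · exact hmin ⟨hge, hle⟩
  · exact hℓ₀R.trans (uniformRT_optSpacing_lt hΛ hgt).le

/-- **THE MINIMISER IS UNIQUE** (strict log-convexity). [ours] -/
theorem isMinOn_uniformRT_unique {Λ ℓ₁ ℓ₂ : ℝ} (hΛ : 0 < Λ) (hℓ₁ : 0 < ℓ₁) (hℓ₂ : 0 < ℓ₂)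
    (h₁ : IsMinOn (uniformRT Λ) (Ioi 0) ℓ₁) (h₂ : IsMinOn (uniformRT Λ) (Ioi 0) ℓ₂) : ℓ₁ = ℓ₂ := by
  -- minimisers of `uniformRT` are minimisers of its logarithm
  have hlog : ∀ {ℓ}, 0 < ℓ → IsMinOn (uniformRT Λ) (Ioi 0) ℓ → IsMinOn (logUniformRT Λ) (Ioi 0) ℓ := by
    intro ℓ hℓ hm x hx
    show logUniformRT Λ ℓ ≤ logUniformRT Λ x
    rw [← log_uniformRT hΛ hℓ, ← log_uniformRT hΛ hx]
    exact Real.log_le_log (uniformRT_pos hΛ hℓ) (hm hx)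
  exact (strictConvexOn_logUniformRT hΛ).eq_of_isMinOn (hlog hℓ₁ h₁) (hlog hℓ₂ h₂) hℓ₁ hℓ₂

/-- **EXACTLY ONE OPTIMAL SPACING `ℓ_Λ` for every `Λ > 0`.** [ours] -/
theorem existsUnique_isMinOn_uniformRT {Λ : ℝ} (hΛ : 0 < Λ) :
    ∃! ℓ₀ : ℝ, 0 < ℓ₀ ∧ IsMinOn (uniformRT Λ) (Ioi 0) ℓ₀ := by
  obtain ⟨ℓ₀, hℓ₀, hmin⟩ := exists_isMinOn_uniformRT hΛ
  exact ⟨ℓ₀, ⟨hℓ₀.1, hmin⟩, fun ℓ h => isMinOn_uniformRT_unique hΛ h.1 hℓ₀.1 h.2 hmin⟩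

/-- **EVERY MINIMISER LIES IN `(0, ℓ⋆]` AND ACCEPTS WITH PROBABILITY `≥ a⋆`**: `ℓ₀ ≤ optSpacing` and
`aOpt ≤ erfc(ℓ₀/(2√2))`. [ours] -/
theorem erfc_argmin_ge_aOpt {Λ ℓ₀ : ℝ} (hΛ : 0 < Λ) (hℓ₀ : 0 < ℓ₀)
    (hmin : IsMinOn (uniformRT Λ) (Ioi 0) ℓ₀) : ℓ₀ ≤ optSpacing ∧ aOpt ≤ erfc (ℓ₀ / (2 * sqrt 2)) := by
  obtain ⟨ℓ₁, hℓ₁, hmin₁⟩ := exists_isMinOn_uniformRT hΛ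
  have heq : ℓ₀ = ℓ₁ := isMinOn_uniformRT_unique hΛ hℓ₀ hℓ₁.1 hmin hmin₁
  have hle : ℓ₀ ≤ optSpacing := heq ▸ hℓ₁.2
  refine ⟨hle, ?_⟩
  rw [← erfc_optSpacing]
  exact strictAnti_erfc.antitone (div_le_div_of_nonneg_right hle two_mul_sqrt_two_pos.le)

end Argmin

end Summit.Ventures.LatticeQCDFlow.Scaling

end
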